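import Summits.ResolutionOfSingularities.ResolutionOfSingularities.Theorems.PurelyInseparableDim4ResConeHeavyEntryFrame
import Summits.ResolutionOfSingularities.ResolutionOfSingularities.Theorems.PurelyInseparableDim4PhiLineIsolationLetters
import HarnessLib
import HarnessLib.Audit.Tags

/-!
# Purely inseparable four-folds — the ENTRY FRAME FOR A LETTER SET: a LIGHT transversal letter `u₁ = x_W` is Φ-admissible when the
# letters cone-aligned with `W` carry the missing weight (E-side reading of (K-Φ1) for letter sets; K2(p) lane, RUNG 1; cell `res-dim4-pi`)

[OURS · counted 0 · cell `res-dim4-pi` · K2(p) lane holder res-dim4-p-12 g5 (rulings g5-3 (5)/(7): «p-9 = cone-letter geometry of the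
light letter»); seat res-dim4-p-9 g5 (E lineage: `entryFrame_of_transversal` p709142, `…ConeLetterEntry` p711866) over res-dim4-p-11 g5's
(K-Φ1) for letter SETS `PhiLine.mul_alphaS_le_of_isIsolated_letters` (p711809).]  Nothing here proves any TAIL(p, d, e), K2(p), K2(7)
or resolution of singularities in dimension ≥ 4 / characteristic `p` — NOT proved.  AI kernel work, weaker than expert review.

E_gen's `entryFrame_of_transversal` reads ONE letter: `u₁ = x_W` transversal (`∃ w ∈ resVertex s, w_W ≠ 0`) and `p ≤ r_W + n`, `n ≤ d`
— so a LIGHT letter (`r_W + d < p`) gets a frame but no α-bound.  p-11's letter-set (K-Φ1) bounds `α` as soon as a SET `T` of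
boundary letters lying in the frame ideal `(y₁, y₂, u₁)` has `p ≤ Σ_{i∈T} r_i + n`.  In the entry frame built on a transversal `W`
the condition «`x_i ∈ (y₁, y₂, x_W)`» is GEOMETRIC and frame-free: **`resVertex s ⊓ H_W ≤ H_i`** (every kernel vector with
`W`-coordinate `0` has `i`-coordinate `0`; the `u₂`-column of the inverse frame spans `resVertex s ⊓ H_W`).  In particular EVERY
CONE LETTER (`resVertex s ≤ H_i`, `…ConeLetterEntry`) is cone-aligned with every `W` — frozen cone letters lend their weight to
the active letter's Φ-entry.
* §1 `exists_transversal_frame` — the linear algebra of E_gen's frame, exported: rows `u₁ = e_W`, `u₂ = e_m`, y-rows through the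
  kernel, inverse columns `m₃, m₄ ∈ resVertex s` with `m₄ ∈ H_W`.
* §2 **`entryFrame_of_transversal_letters`** (state level, ∀ (p, d, n)): isolated `x^r·G`, `ord₀ = |r| + d`, `d < p`, `e_G = 2`,
  `W` transversal, `T` with `∀ i ∈ T, i ≠ W → resVertex s ⊓ H_W ≤ H_i` and `p ≤ Σ_{i∈T} r_i + n`, `n ≤ d` ⟹ the entry 6-tuple
  (`M·L = 1`, `L u₁ = e_W`, y-rows ⟂ `resVertex s`, `pts ≠ ∅`, `d! < δs`, `d·αs ≤ (n−1)·d!`).  `T = {W}` is `entryFrame_of_transversal`.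
* §3 **`tail_entryFrame_letters`** — chain dress on a constant-shade `e_G = 2` tail (transversal vector arbitrary: the step direction at a
  hit, or the vector of `…ConeLetterEntry.transversal_of_le_of_permanent` for a permanent letter).
Whether the cone-aligned position occurs on the open rung-0 rows is a census question, not claimed here.
[cite: CossartJannsenSaito2020, Def. 8.4, Lemma 11.5, Lemma 12.2 (2), Lemma 13.4 (3)] [cite: CossartPiltant2008, §4 p. 11]
bears_on: LADDER-RESOLUTION:D157-DOOR2 (res-dim4-pi · K2(p) · RUNG 1 letter-set entry frame).  Supports
stmt-ResolutionOfSingularities-16155 (helper).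
-/

set_option linter.dupNamespace false -- mandated namespace of this single-conjunct summit

noncomputable section

namespace Summit.ResolutionOfSingularities.ResolutionOfSingularities.Theorems.PIDim4

namespace ResCone

open MvPolynomial Finset IsLocalRing
open Literature.AlgebraicGeometry.Resolution
open Literature.AlgebraicGeometry.Resolution.CentreBlowup
open Literature.AlgebraicGeometry.Resolution.Hauser2010
open Literature.AlgebraicGeometry.Resolution.HauserPerlega2019
open Literature.AlgebraicGeometry.Resolution.WeightedOrder
open PointBlowup (additiveSubspace direction)

variable {K : Type} [Field K]

/-! ## 1. The transversal frame (linear algebra of E_gen's entry frame, exported) -/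

/-- **THE TRANSVERSAL FRAME.**  If `V ≤ K⁴` has dimension `2` and contains a vector `w` with `w_W ≠ 0`, there are a letter `m ≠ W`,
rows `L` (`u₁ = e_W`, `u₂ = e_m`) with left inverse `M`, whose y-rows annihilate `V`, and whose inverse `u`-columns `m₃ = M·u₁`,
`m₄ = M·u₂` lie in `V` with `m₃ W = 1`, `m₄ W = 0`, `m₄ m = 1` (`exists_dualColumns` + `entryRows_mul` of `…BInfEntryFrame`). [OURS]
[cite: CossartJannsenSaito2020, Def. 8.2] -/
theorem exists_transversal_frame {V : Submodule K (Fin 4 → K)} (hV : Module.finrank K V = 2) {W : Fin 4} {w : Fin 4 → K}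
    (hwV : w ∈ V) (hwW : w W ≠ 0) :
    ∃ (L : Fin (2 + 2) → Fin 4 → K) (M : Fin 4 → Fin (2 + 2) → K) (m : Fin 4) (m₃ m₄ : Fin 4 → K),
      (∀ t u, ∑ i, M t i * L i u = if t = u then 1 else 0) ∧ L (u1 2) = Pi.single W 1 ∧ L (u2 2) = Pi.single m 1 ∧ m ≠ W ∧
      (∀ t, M t (u1 2) = m₃ t) ∧ (∀ t, M t (u2 2) = m₄ t) ∧ m₃ ∈ V ∧ m₄ ∈ V ∧ m₃ W = 1 ∧ m₄ W = 0 ∧ m₄ m = 1 ∧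
      (∀ i, i ≠ u1 2 → i ≠ u2 2 → ∀ v ∈ V, ∑ t, L i t * v t = 0) := by
  classical
  obtain ⟨m, m₃, m₄, hmW, hm₃V, hm₄V, h₃W, h₃m, h₄W, h₄m⟩ := exists_dualColumns hV hwV hwW
  obtain ⟨a, a', haW, ham, ha'W, ha'm, haa', hall⟩ := exists_two_other_letters (Ne.symm hmW)
  set rowA : Fin 4 → K := fun u =>
    (Pi.single a 1 : Fin 4 → K) u - m₃ a * (Pi.single W 1 : Fin 4 → K) u - m₄ a * (Pi.single m 1 : Fin 4 → K) u with hrowA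
  set rowA' : Fin 4 → K := fun u =>
    (Pi.single a' 1 : Fin 4 → K) u - m₃ a' * (Pi.single W 1 : Fin 4 → K) u - m₄ a' * (Pi.single m 1 : Fin 4 → K) u with hrowA'
  set L : Fin (2 + 2) → Fin 4 → K := fun i =>
    if i = u1 2 then Pi.single W 1 else if i = u2 2 then Pi.single m 1 else if i = 0 then rowA else rowA' with hL
  set M : Fin 4 → Fin (2 + 2) → K := fun t i =>
    if i = u1 2 then m₃ t else if i = u2 2 then m₄ t else if i = 0 then (Pi.single a 1 : Fin 4 → K) t
      else (Pi.single a' 1 : Fin 4 → K) t with hM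
  obtain ⟨h0u1, h0u2, h1u1, h1u2, h01, hu12⟩ := frameIndex_ne
  have hLu1 : L (u1 2) = Pi.single W 1 := by rw [hL]; exact if_pos rfl
  have hLu2 : L (u2 2) = Pi.single m 1 := by rw [hL]; simp only [if_neg (Ne.symm hu12), if_pos]
  have hL0 : L 0 = rowA := by rw [hL]; simp only [if_neg h0u1, if_neg h0u2, if_pos]
  have hL1 : L 1 = rowA' := by rw [hL]; simp only [if_neg h1u1, if_neg h1u2, if_neg (Ne.symm h01)]
  have hMu1 : ∀ t, M t (u1 2) = m₃ t := fun t => by rw [hM]; exact if_pos rfl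
  have hMu2 : ∀ t, M t (u2 2) = m₄ t := fun t => by rw [hM]; simp only [if_neg (Ne.symm hu12), if_pos]
  have hM0 : ∀ t, M t 0 = (Pi.single a 1 : Fin 4 → K) t := fun t => by rw [hM]; simp only [if_neg h0u1, if_neg h0u2, if_pos]
  have hM1 : ∀ t, M t 1 = (Pi.single a' 1 : Fin 4 → K) t := fun t => by
    rw [hM]; simp only [if_neg h1u1, if_neg h1u2, if_neg (Ne.symm h01)]
  have hinv : ∀ t u, ∑ i, M t i * L i u = if t = u then 1 else 0 := by
    intro t u
    rw [sum_frameIndex, hM0, hM1, hMu1, hMu2, hL0, hL1, hLu1, hLu2]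
    exact entryRows_mul haW ham ha'W ha'm haa' (Ne.symm hmW) hall h₃W h₃m h₄W h₄m t u
  have hy : ∀ i, i ≠ u1 2 → i ≠ u2 2 → ∀ v ∈ V, ∑ t, L i t * v t = 0 := by
    intro i hi1 hi2 v hvV
    have hdec := apply_eq_of_mem_plane hV hm₃V hm₄V h₃W h₃m h₄W h₄m hvV
    rcases frameIndex_cases i with hi | hi | hi | hi
    · rw [hi, hL0, hrowA, entryRow_dot, hdec a, hdec W, hdec m, h₃W, h₃m, h₄W, h₄m]; ring
    · rw [hi, hL1, hrowA', entryRow_dot, hdec a', hdec W, hdec m, h₃W, h₃m, h₄W, h₄m]; ring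
    · exact absurd hi hi1
    · exact absurd hi hi2
  exact ⟨L, M, m, m₃, m₄, hinv, hLu1, hLu2, hmW, hMu1, hMu2, hm₃V, hm₄V, h₃W, h₄W, h₄m, hy⟩

/-- **A letter cone-aligned with `u₁` lies in the frame ideal `(y₁, y₂, u₁)`.**  In a frame with `M·L = 1`, `L u₁ = e_W` and inverse
`u₂`-column `m₄`, a letter `i` with `m₄ i = 0` has `x_i = Σ_k M_{i y_k}·ℓ_{y_k} + M_{i u₁}·x_W`, hence `x_i ∈ yu1Ideal` of the frame read in
`𝒪 = K[x]_{(x)}`. [OURS] [cite: CossartJannsenSaito2020, Def. 8.2] -/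
theorem algebraMap_X_mem_yu1Ideal_of_column_eq_zero {L : Fin (2 + 2) → Fin 4 → K} {M : Fin 4 → Fin (2 + 2) → K}
    (hM : ∀ t u, ∑ i, M t i * L i u = if t = u then 1 else 0) {i : Fin 4} (hi : M i (u2 2) = 0) :
    algebraMap (MvPolynomial (Fin 4) K) (OriginLocalization K 4) (X i) ∈
      yu1Ideal (fun idx => algebraMap (MvPolynomial (Fin 4) K) (OriginLocalization K 4) (∑ t, C (L idx t) * X t)) := by
  refine PhiLine.algebraMap_X_mem_yu1Ideal_of_eq_sum (fun k => M i (Fin.castAdd 2 k)) (M i (u1 2)) ?_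
  have hX := X_eq_sum_C_mul_linearForm hM i
  rw [Fin.sum_univ_add] at hX
  have h2 : (∑ k : Fin 2, C (M i (Fin.natAdd 2 k)) * ∑ s, C (L (Fin.natAdd 2 k) s) * X s : MvPolynomial (Fin 4) K) =
      C (M i (u1 2)) * ∑ s, C (L (u1 2) s) * X s := by
    rw [Fin.sum_univ_two]
    change C (M i (u1 2)) * (∑ s, C (L (u1 2) s) * X s) + C (M i (u2 2)) * (∑ s, C (L (u2 2) s) * X s) = _
    rw [hi, C_0, zero_mul, add_zero]
  rw [h2] at hX
  rw [hX, map_add, map_sum]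
  simp only [map_mul]

/-! ## 2. The entry frame for a letter set (state level) -/

section Entry

variable {p : ℕ} [CharP K p]

/-- **THE ENTRY FRAME FOR A LETTER SET, ANY PRIME `p`, ANY TAME SHADE** (state level; `T = {W}` is `entryFrame_of_transversal`).  Let `s`
be a presented state with `x^{s.r} ∣ s.F`, `s.F` isolated, `ord₀ s.F = |r| + d`, `d < p`, `e_G = 2`; let `W` be a letter with a
TRANSVERSAL kernel vector (`w ∈ resVertex s`, `w_W ≠ 0`) and `T` a set of letters CONE-ALIGNED with `W`
(`∀ i ∈ T, i ≠ W → ∀ v ∈ resVertex s, v W = 0 → v i = 0`, i.e. `resVertex s ⊓ H_W ≤ H_i`; every cone letter qualifies) with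
`p ≤ Σ_{i∈T} r_i + n`, `n ≤ d`.  Then there is a linear frame `L` with left inverse `M`, `L u₁ = e_W`, y-rows annihilating
`resVertex s`, and for `(G)`, `G = s.F / x^{s.r}`, at level `d`: `pts ≠ ∅`, `d! < δs`, `d·αs ≤ (n − 1)·d!` — the α-bound now by
res-dim4-p-11 g5's `PhiLine.mul_alphaS_le_of_isIsolated_letters` (the letters of `T` lie in `(y₁, y₂, u₁)` because the inverse
`u₂`-column spans `resVertex s ⊓ H_W`). [OURS] [cite: CossartJannsenSaito2020, Def. 8.4, Lemma 11.5, Lemma 12.2 (2)]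
[cite: CossartPiltant2008, §4 p. 11] -/
theorem entryFrame_of_transversal_letters {d n : ℕ} (hdp : d < p) (hnd : n ≤ d) {s : State K} (hiso : IsIsolated p s.F)
    (hrs : ∀ e ∈ s.F.support, s.r ≤ e) (ho : ordZero s.F = ((s.r.degree + d : ℕ) : ℕ∞))
    (he : Module.finrank K (resVertex s) = 2) {W : Fin 4} {w : Fin 4 → K} (hwV : w ∈ resVertex s) (hwW : w W ≠ 0)
    (T : Finset (Fin 4)) (hT : ∀ i ∈ T, i ≠ W → ∀ v ∈ resVertex s, v W = 0 → v i = 0) (hn : p ≤ ∑ i ∈ T, s.r i + n) :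
    ∃ (L : Fin (2 + 2) → Fin 4 → K) (M : Fin 4 → Fin (2 + 2) → K),
      (∀ t u, ∑ i, M t i * L i u = if t = u then 1 else 0) ∧ L (u1 2) = Pi.single W 1 ∧
      (∀ i, i ≠ u1 2 → i ≠ u2 2 → ∀ v ∈ resVertex s, ∑ t, L i t * v t = 0) ∧
      (pts (fun i => algebraMap (MvPolynomial (Fin 4) K) (OriginLocalization K 4) (∑ t, C (L i t) * X t))
        (Ideal.span {algebraMap (MvPolynomial (Fin 4) K) (OriginLocalization K 4) (s.F.divMonomial s.r)}) d).Nonempty ∧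
      Nat.factorial d < deltaS (fun i => algebraMap (MvPolynomial (Fin 4) K) (OriginLocalization K 4)
        (∑ t, C (L i t) * X t)) (Ideal.span {algebraMap (MvPolynomial (Fin 4) K) (OriginLocalization K 4)
          (s.F.divMonomial s.r)}) d ∧
      d * alphaS (fun i => algebraMap (MvPolynomial (Fin 4) K) (OriginLocalization K 4) (∑ t, C (L i t) * X t))
        (Ideal.span {algebraMap (MvPolynomial (Fin 4) K) (OriginLocalization K 4)
          (s.F.divMonomial s.r)}) d ≤ (n - 1) * Nat.factorial d := by
  classical
  have hF : s.F = monomial s.r 1 * s.F.divMonomial s.r := eq_monomial_mul_divMonomial hrs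
  obtain ⟨L, M, m, m₃, m₄, hinv, hLu1, -, hmW, hMu1, hMu2, hm₃V, hm₄V, -, h₄W, h₄m, hy⟩ :=
    exists_transversal_frame he hwV hwW
  -- polygon data in `𝒪`
  have hgen := PhiLine.span_range_linearFrame_eq_maximalIdeal L M hinv
  have hdim := PhiLine.ringKrullDim_originLocalization_two_add_two (K := K)
  have hu1' : (fun i => algebraMap (MvPolynomial (Fin 4) K) (OriginLocalization K 4) (∑ t, C (L i t) * X t)) (u1 2) =
      algebraMap (MvPolynomial (Fin 4) K) (OriginLocalization K 4) (X W) := by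
    show algebraMap _ _ (∑ t, C (L (u1 2) t) * X t) = _
    rw [hLu1, PhiLine.sum_C_single_mul_X]
  -- the letters of `T` lie in `(y₁, y₂, u₁)`
  have hTmem : ∀ i ∈ T, algebraMap (MvPolynomial (Fin 4) K) (OriginLocalization K 4) (X i) ∈
      yu1Ideal (fun idx => algebraMap (MvPolynomial (Fin 4) K) (OriginLocalization K 4) (∑ t, C (L idx t) * X t)) := by
    intro i hi
    by_cases hiW : i = W
    · rw [hiW]; exact PhiLine.algebraMap_X_mem_yu1Ideal_of_eq hu1'
    · exact algebraMap_X_mem_yu1Ideal_of_column_eq_zero hinv (by rw [hMu2]; exact hT i hi hiW m₄ hm₄V h₄W)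
  obtain ⟨hne, hα⟩ := PhiLine.mul_alphaS_le_of_isIsolated_letters (d := d) (n := n) hF hiso T hn hnd _ hgen hTmem
  refine ⟨L, M, hinv, hLu1, hy, hne, ?_, hα⟩
  -- the label: `G ∈ (ℓ_y)^d ⊔ 𝔪₀^{d+1}`
  have hhom : (resForm s).IsHomogeneous d := by
    have h := resForm_isHomogeneous ho
    rwa [show s.r.degree + d - s.r.degree = d by omega] at h
  have hgd : resForm s ∈ MvPolynomial.idealOfVars (Fin 4) K ^ d := by
    rw [MvPolynomial.mem_pow_idealOfVars_iff']
    intro x hx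
    by_contra hne'
    have := hhom hne'
    rw [weight_one_eq_degree] at this
    omega
  have hcol1 : (fun t => M t (u1 2)) ∈ additiveSubspace (resForm s) := by
    rw [show (fun t => M t (u1 2)) = m₃ from funext hMu1]; exact hm₃V
  have hcol2 : (fun t => M t (u2 2)) ∈ additiveSubspace (resForm s) := by
    rw [show (fun t => M t (u2 2)) = m₄ from funext hMu2]; exact hm₄V
  have hlabel := residual_mem_label_deg d ho
    (label_of_dual_columns_char p d hinv hgd (lt_of_le_of_lt hhom.totalDegree_le hdp) hcol1 hcol2)
  exact (PhiLine.factorial_lt_deltaS_span_singleton_iff _ d hgen hdim hne).mpr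
    (PhiLine.algebraMap_mem_yIdeal_pow_sup L hlabel)

end Entry

/-! ## 3. The chain dress -/

section Chain

variable {p : ℕ} [Fact p.Prime] [CharP K p] [DecidableEq K]

/-- **THE LETTER-SET ENTRY FRAME ON THE CHAIN, any prime `p`.**  Along an isolated above-floor `Step0 p` chain (no step witnesses needed) with
`x^{r₀} ∣ F₀`, constant shade `d < p` and `e_G = 2` from `k₀`, at any `k ≥ k₀` with a letter `W` carrying a TRANSVERSAL kernel vector
(the step direction at a hit — `chain_direction_mem_resVertex` —, or the vector of `transversal_of_le_of_permanent` for a permanent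
letter), and a set `T` of letters cone-aligned with `W` at `k` with `p ≤ Σ_{i∈T} r_k i + n`, `n ≤ d`: the entry 6-tuple at `k` with
`u₁ = e_W`. [OURS] [cite: CossartJannsenSaito2020, Def. 8.4, Lemma 11.5, Lemma 12.2 (2)] [cite: CossartPiltant2008, §4 p. 11] -/
theorem tail_entryFrame_letters {d n : ℕ} (hdp : d < p) (hnd : n ≤ d) {c : ℕ → State K}
    (hc : ∀ k, IsIsolated p (c k).F ∧ Step0 p (c k) (c (k + 1)))
    (hr0 : ∀ e ∈ (c 0).F.support, (c 0).r ≤ e) (hfloor : ∀ k, ordZero (c k).F ≠ p) {k₀ : ℕ}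
    (hshade : ∀ k, k₀ ≤ k → (c k).shade = ((d : ℕ) : ℕ∞))
    (he : ∀ k, k₀ ≤ k → Module.finrank K (resVertex (c k)) = 2)
    {k : ℕ} (hk : k₀ ≤ k) {W : Fin 4} {w : Fin 4 → K} (hwV : w ∈ resVertex (c k)) (hwW : w W ≠ 0)
    (T : Finset (Fin 4)) (hT : ∀ i ∈ T, i ≠ W → ∀ v ∈ resVertex (c k), v W = 0 → v i = 0)
    (hn : p ≤ ∑ i ∈ T, (c k).r i + n) :
    ∃ (L : Fin (2 + 2) → Fin 4 → K) (M : Fin 4 → Fin (2 + 2) → K),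
      (∀ t u, ∑ i, M t i * L i u = if t = u then 1 else 0) ∧ L (u1 2) = Pi.single W 1 ∧
      (∀ i, i ≠ u1 2 → i ≠ u2 2 → ∀ v ∈ resVertex (c k), ∑ t, L i t * v t = 0) ∧
      (pts (fun i => algebraMap (MvPolynomial (Fin 4) K) (OriginLocalization K 4) (∑ t, C (L i t) * X t))
        (Ideal.span {algebraMap (MvPolynomial (Fin 4) K) (OriginLocalization K 4)
          ((c k).F.divMonomial (c k).r)}) d).Nonempty ∧
      Nat.factorial d < deltaS (fun i => algebraMap (MvPolynomial (Fin 4) K) (OriginLocalization K 4)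
        (∑ t, C (L i t) * X t)) (Ideal.span {algebraMap (MvPolynomial (Fin 4) K) (OriginLocalization K 4)
          ((c k).F.divMonomial (c k).r)}) d ∧
      d * alphaS (fun i => algebraMap (MvPolynomial (Fin 4) K) (OriginLocalization K 4) (∑ t, C (L i t) * X t))
        (Ideal.span {algebraMap (MvPolynomial (Fin 4) K) (OriginLocalization K 4)
          ((c k).F.divMonomial (c k).r)}) d ≤ (n - 1) * Nat.factorial d :=
  entryFrame_of_transversal_letters hdp hnd (hc k).1 (IsolatedBand.isolated_chain_forall_le hc hr0 k)
    (tail_ordZero_eq hc hr0 hfloor hshade hk).1 (he k hk) hwV hwW T hT hn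

end Chain

end ResCone

end Summit.ResolutionOfSingularities.ResolutionOfSingularities.Theorems.PIDim4

end
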